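import Summits.QuantumFields.YangMills.Theorems.BalabanLadderIRColdPurityGaussLawConcentration
import Summits.QuantumFields.YangMills.Theorems.BalabanLadderIRColdPuritySlabDecoupling
import HarnessLib

/-!
# Route `BalabanLadder`, crux `IR` (stmt-QuantumFields-19354): QUADRATIC kernel purity bound
# `coldDefect ρ β L ≤ 1 − e^{−9n²β²L⁶} ≤ 9·n²·β²·L⁶` and Hopf's explicit transfer gap with `tanh((9/4)n²β²L⁶)`
# (part 2 of 2; part 1 = `BalabanLadderIRColdPurityGaussLawConcentration.lean`)

Instrument seat `ym-ir-eng-2` (generation g6, transfer-matrix lane), cell `pub/ym-ir` (`--supports stmt-QuantumFields-19354`,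
helper; no registered stub is claimed).  Part 1 proved that the Gauss-law factor `I_β(U,V) = ∫e^{−βS_tm(U,g,V)}dg` of the
Wilson time-slice kernel satisfies `e^{−βS̄} ≤ I_β(U,V) ≤ e^{−βS̄}·e^{(9/2)n²β²L⁶}` with a slice-INDEPENDENT `S̄` (`L ≥ 2`).
Here this is fed (§1) into `ym-ir-eng-4`'s model-free cut estimate
`ColdPuritySlabDecoupling.sq_integral_cyclicProd_le_exp_mul_integral_cyclicProd` (p629613, credited and imported, not
restated) and (§2) into Hopf's inequality exactly as `Literature/…/WilsonTorusTransferGapExplicit.lean` (lit-4) does with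
its linear diameter.

**What is proved (all `theorem`s, hypothesis-free, group-blind).**  `G` compact second countable, `ρ` continuous unitary
of dimension `n`, `β ≥ 0`:
* `wilsonSliceKernel_two_sided_sq` (`L ≥ 2`): a measurable `a : slices → [0,1]` with
  `e^{−(9/2)n²β²L⁶}·a(U)a(V) ≤ K_β(U,V) ≤ a(U)a(V)` — namely `a = √(min 1 e^{−βS̄+(9/2)n²β²L⁶})·e^{−βS₃/2}`;
* `cyclicPartition_sq_le_exp_sq_mul_cyclicPartition`, `wilsonFinTorusPartition_sq_le_exp_sq_mul_two_mul`,
  `exp_neg_sq_le_wilsonFinTorusPartition_ratio`: **`Z_β(L³×t)² ≤ e^{9n²β²L⁶}·Z_β(L³×2t)`** (`L ≥ 2`, `t ≥ 1`);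
* `coldDefect_le_one_sub_exp_sq`, `coldDefect_le_sq_mul`, `coldDefect_le_of_sq_mul_le` (`L ≥ 4`):
  **`coldDefect ρ β L ≤ 1 − e^{−9n²β²L⁶} ≤ 9·n²·β²·L⁶`** (tree functional `ColdPurityBridge.coldDefect`);
* `coldDefect_latticeRep_le_sq_mul`, **`coldDefect_eight_le_one_div_24_of_sq`** (`7525·N·β ≤ 1 ⇒ δᶜ_β(8) ≤ 1/24`),
  `coldDefect_eight_le_inv_two_pow_six_of_sq` (`12288·N·β ≤ 1 ⇒ δᶜ_β(8) ≤ 2⁻⁶`) for `r : LatticeRep G` of dimension `N`;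
* `abs_eigenvalue_le_tanh_sq_mul` (any real `β`, `L ≥ 2`): every eigenvalue of `𝕋 = wilsonTorusTransferMatrix ρ β L` other
  than the top one has `|λᵢ| ≤ tanh((9/4)n²β²L⁶)·‖𝕋‖`; `transferOperatorGap_of_tanh_sq_le`, `transferGap_of_tanh_sq_le`,
  `transferGap_neg_log_tanh_sq` (`S ≥ 1`): `TransferGap ρ β S (−log tanh((9/4)n²β²(2S+1)⁶))`.

**Reading.**  `SU(2)`, fundamental (`n = 2`, Wilson `β_W = 2β`), the decl's MINIMUM box `L = 8`: THE NUMBER's inequality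
`δᶜ_β(8) ≤ 1/24` holds in the kernel for `0 ≤ β_W ≤ 1/7525 ≈ 1.33·10⁻⁴` — TWENTY times the linear slab window
`β_W ≤ 1/147456 ≈ 6.8·10⁻⁶` of `ColdPuritySlabDecoupling.coldDefect_eight_le_one_div_24` (at threshold `θ` the two
windows are `√θ/(3nL³)` and `θ/(12nL³)`: ratio `4/√θ`, independent of `L` and `n`; `4√24 ≈ 19.6`).
Still ≈ 165–270× BELOW the cell's certified-CONDITIONAL corner (`β_W ≤ 0.022–0.036` at `L = 8`, conditional on KP86 +
a paper lemma; E4-P7 / E2-Q2), which is NOT a Lean theorem and is not changed by this file.  The transfer-gap value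
`−log tanh((9/4)n²β²L⁶)` is logarithmically large as `β → 0` at fixed `L`, where lit-4's `−log tanh(3nβL³)` is
`≈ −log(3nβL³)` as well but with the exponentially small elementary floor `e^{−6nβL³}`; both vanish as `L → ∞`.

HONEST FRAMING.  Small-`β` bookkeeping in the kernel, group-blind (it holds verbatim for `U(1)`), width 0 toward `PX` /
`PXcof` (β → ∞ objects); a finite-volume transfer gap is NOT a mass gap; `BalabanLadder.IR` / `.IRcof` are NOT closed
(0/1); the Yang–Mills mass gap (Clay) is NOT proved by any of this; R4 closes only the conditional finite-𝕋⁴ rung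
`BalabanLadder.UV`.
-/

noncomputable section

open MeasureTheory Filter Function Set
open scoped RealInnerProductSpace
open Literature.MathematicalPhysics.QuantumFieldTheory
open Literature.Analysis.OperatorTheory Literature.Dynamics.Contraction.BirkhoffHopf
open Literature.MathematicalPhysics.QuantumFieldTheory.Balaban1983to89.Sufficient

namespace Summit.QuantumFields.YangMills.Cruxes.IR.ColdPurityGaussLaw

open Summit.QuantumFields.YangMills.Cruxes.IR.ColdPurityBridge (coldDefect)
open Summit.QuantumFields.YangMills.Cruxes.IR.ColdPuritySlabDecoupling
  (sq_integral_cyclicProd_le_exp_mul_integral_cyclicProd)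

/-! ## §1 Period doubling `Z(L³×t)² ≤ e^{9n²β²L⁶} Z(L³×2t)` and the purity bound `coldDefect ≤ 9 n² β² L⁶` -/

section Purity

variable {G : Type} [Group G] [TopologicalSpace G] [IsTopologicalGroup G] [CompactSpace G]
  [MeasurableSpace G] [BorelSpace G] [SecondCountableTopology G] {n : ℕ} (ρ : G →* Matrix (Fin n) (Fin n) ℂ)
  {N : ℕ} [NeZero N]

/-- **TWO-SIDED RANK-ONE BOUND WITH A QUADRATIC EXPONENT.**  `β ≥ 0`, `N ≥ 2`, continuous unitary `ρ`.  With
`S̄ = ∫ S_tm(1, g, 1) dg` (the slice-free mean, `integral_sliceTemporalAction_eq`), `c = (9/2) n² β² N⁶`,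
`M = min 1 e^{−βS̄ + c}` and `a(U) = √M · e^{−β S₃(U)/2} ∈ [0, 1]`:
`e^{−c} a(U) a(V) ≤ K_β(U, V) ≤ a(U) a(V)` for the Wilson slice kernel `K_β = wilsonSliceKernel ρ β`. [folklore] -/
theorem wilsonSliceKernel_two_sided_sq (hρ : Continuous ρ) (hρu : ∀ g, ρ g ∈ Matrix.unitaryGroup (Fin n) ℂ)
    {β : ℝ} (hβ : 0 ≤ β) (hN : 2 ≤ N) :
    ∃ a : GaugeConfig 3 N G → ℝ, Measurable a ∧ (∀ U, 0 ≤ a U) ∧ (∀ U, a U ≤ 1) ∧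
      (∀ U V, Real.exp (-(9 / 2 * (n : ℝ) ^ 2 * β ^ 2 * (N : ℝ) ^ 6)) * (a U * a V) ≤ wilsonSliceKernel ρ β U V) ∧
      (∀ U V, wilsonSliceKernel ρ β U V ≤ a U * a V) := by
  set μ : Measure (Site 3 N → G) := Measure.pi fun _ => haarProbability G with hμ
  set Sbar : ℝ := ∫ g : Site 3 N → G, sliceTemporalAction ρ 1 g 1 ∂μ with hSbar
  set c : ℝ := 9 / 2 * (n : ℝ) ^ 2 * β ^ 2 * (N : ℝ) ^ 6 with hc
  set M : ℝ := min 1 (Real.exp (-(β * Sbar) + c)) with hM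
  have hM0 : 0 ≤ M := le_min zero_le_one (Real.exp_pos _).le
  have hM1 : M ≤ 1 := min_le_left _ _
  set m : ℝ := Real.sqrt M with hm
  have hm0 : 0 ≤ m := Real.sqrt_nonneg _
  have hm1 : m ≤ 1 := Real.sqrt_le_one.mpr hM1 |>.trans_eq' rfl
  have hmm : m * m = M := Real.mul_self_sqrt hM0
  set α : GaugeConfig 3 N G → ℝ := fun U => Real.exp (-(β * wilsonAction ρ U / 2)) with hα
  have hα0 : ∀ U, 0 ≤ α U := fun U => (Real.exp_pos _).le
  have hα1 : ∀ U, α U ≤ 1 := fun U => exp_neg_half_wilsonAction_le_one ρ hρu hβ U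
  have hαm : Measurable α :=
    (((WilsonRP.measurable_wilsonAction (d := 3) (L := N) ρ hρ).const_mul β).div_const 2).neg.exp
  -- the Gauss-law factor and its two-sided bound with the common factor `e^{-βS̄}`
  set I : GaugeConfig 3 N G → GaugeConfig 3 N G → ℝ :=
    fun U V => ∫ g, Real.exp (-(β * sliceTemporalAction ρ U g V)) ∂μ with hI
  have hIlo : ∀ U V, Real.exp (-(β * Sbar)) ≤ I U V := fun U V => by
    have h := exp_neg_mul_integral_le_gaussLaw ρ hρ hρu β U V
    rwa [integral_sliceTemporalAction_eq ρ hρ hρu hN U V 1 1] at h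
  have hIhi : ∀ U V, I U V ≤ Real.exp (-(β * Sbar) + c) := fun U V => by
    have h := gaussLaw_le_exp_neg_mul_integral_mul_exp ρ hρ hρu β U V
    rwa [integral_sliceTemporalAction_eq ρ hρ hρu hN U V 1 1, ← Real.exp_add] at h
  have hI1 : ∀ U V, I U V ≤ 1 := fun U V =>
    (WilsonTransferGapExplicit.exp_neg_le_integral_exp_neg_sliceTemporalAction_le ρ hρ hρu hβ U V).2
  have hIM : ∀ U V, I U V ≤ M := fun U V => le_min (hI1 U V) (hIhi U V)
  have hMI : ∀ U V, Real.exp (-c) * M ≤ I U V := fun U V =>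
    calc Real.exp (-c) * M ≤ Real.exp (-c) * Real.exp (-(β * Sbar) + c) :=
          mul_le_mul_of_nonneg_left (min_le_right _ _) (Real.exp_pos _).le
      _ = Real.exp (-(β * Sbar)) := by rw [← Real.exp_add]; congr 1; ring
      _ ≤ I U V := hIlo U V
  have hK : ∀ U V, wilsonSliceKernel ρ β U V = α U * I U V * α V := fun U V => rfl
  refine ⟨fun U => m * α U, measurable_const.mul hαm, fun U => mul_nonneg hm0 (hα0 U),
    fun U => mul_le_one₀ hm1 (hα0 U) (hα1 U), fun U V => ?_, fun U V => ?_⟩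
  · calc Real.exp (-c) * (m * α U * (m * α V)) = α U * (Real.exp (-c) * M) * α V := by rw [← hmm]; ring
      _ ≤ α U * I U V * α V :=
          mul_le_mul_of_nonneg_right (mul_le_mul_of_nonneg_left (hMI U V) (hα0 U)) (hα0 V)
      _ = wilsonSliceKernel ρ β U V := (hK U V).symm
  · calc wilsonSliceKernel ρ β U V = α U * I U V * α V := hK U V
      _ ≤ α U * M * α V := mul_le_mul_of_nonneg_right (mul_le_mul_of_nonneg_left (hIM U V) (hα0 U)) (hα0 V)
      _ = m * α U * (m * α V) := by rw [← hmm]; ring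

/-- **`Z_β(N³ × t)² ≤ e^{9n²β²N⁶} · Z_β(N³ × m)` for `m = t + t`** (`β ≥ 0`, `N ≥ 2`, continuous unitary `ρ`, `t ≥ 1`):
eng-4's cut estimate `sq_integral_cyclicProd_le_exp_mul_integral_cyclicProd` fed with the quadratic two-sided bound
`wilsonSliceKernel_two_sided_sq`.  Expansion-free, uniform in `t`. [folklore] -/
theorem cyclicPartition_sq_le_exp_sq_mul_cyclicPartition (hρ : Continuous ρ)
    (hρu : ∀ g, ρ g ∈ Matrix.unitaryGroup (Fin n) ℂ) {β : ℝ} (hβ : 0 ≤ β) (hN : 2 ≤ N) (t : ℕ) [NeZero t] {m : ℕ}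
    [NeZero m] (hm : m = t + t) :
    cyclicPartition ρ β N t ^ 2 ≤ Real.exp (9 * (n : ℝ) ^ 2 * β ^ 2 * (N : ℝ) ^ 6) * cyclicPartition ρ β N m := by
  obtain ⟨s, rfl⟩ : ∃ s, t = s + 1 := ⟨t - 1, by have := NeZero.ne t; omega⟩
  obtain ⟨k, rfl⟩ : ∃ k, m = k + 1 := ⟨m - 1, by have := NeZero.ne m; omega⟩
  obtain ⟨a, ha, ha0, ha1, hlo, hhi⟩ := wilsonSliceKernel_two_sided_sq (N := N) ρ hρ hρu hβ hN
  have hK : Measurable (uncurry (wilsonSliceKernel ρ β : GaugeConfig 3 N G → GaugeConfig 3 N G → ℝ)) :=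
    (stronglyMeasurable_uncurry_wilsonSliceKernel ρ hρ β).measurable
  have h := sq_integral_cyclicProd_le_exp_mul_integral_cyclicProd
    (μ := Measure.pi fun _ : Edge 3 N => haarProbability G) hK ha ha0 ha1 hlo hhi (t := s + 1) (m := k + 1) hm
  have he : 2 * (9 / 2 * (n : ℝ) ^ 2 * β ^ 2 * (N : ℝ) ^ 6) = 9 * (n : ℝ) ^ 2 * β ^ 2 * (N : ℝ) ^ 6 := by ring
  rw [he] at h
  unfold cyclicPartition
  exact h

/-- **The `Fin`-torus form: `Z_β(L,L,L,t)² ≤ e^{9n²β²L⁶} · Z_β(L,L,L,2t)`** (`β ≥ 0`, `L ≥ 2`, `t ≥ 1`, continuous unitary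
`ρ`), via `wilsonFinTorusPartition_eq_cyclicPartition`. [folklore] -/
theorem wilsonFinTorusPartition_sq_le_exp_sq_mul_two_mul (hρ : Continuous ρ)
    (hρu : ∀ g, ρ g ∈ Matrix.unitaryGroup (Fin n) ℂ) {β : ℝ} (hβ : 0 ≤ β) {L : ℕ} (hL : 2 ≤ L) (t : ℕ) [NeZero t] :
    haveI : NeZero L := ⟨by omega⟩
    wilsonFinTorusPartition ρ β L L L t ^ 2 ≤
      Real.exp (9 * (n : ℝ) ^ 2 * β ^ 2 * (L : ℝ) ^ 6) * wilsonFinTorusPartition ρ β L L L (2 * t) := by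
  haveI : NeZero L := ⟨by omega⟩
  haveI : NeZero (2 * t) := ⟨by have := NeZero.ne t; omega⟩
  rw [wilsonFinTorusPartition_eq_cyclicPartition hρ hρu β L t,
    wilsonFinTorusPartition_eq_cyclicPartition hρ hρu β L (2 * t)]
  exact cyclicPartition_sq_le_exp_sq_mul_cyclicPartition (N := L) ρ hρ hρu hβ hL t (two_mul t)

/-- **Lower bound on the period-doubling ratio**: `e^{−9n²β²L⁶} ≤ Z_β(L,L,L,2t) / Z_β(L,L,L,t)²` (`β ≥ 0`, `L ≥ 2`,
`t ≥ 1`, continuous unitary `ρ`). [folklore] -/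
theorem exp_neg_sq_le_wilsonFinTorusPartition_ratio (hρ : Continuous ρ)
    (hρu : ∀ g, ρ g ∈ Matrix.unitaryGroup (Fin n) ℂ) {β : ℝ} (hβ : 0 ≤ β) {L : ℕ} (hL : 2 ≤ L) (t : ℕ) [NeZero t] :
    haveI : NeZero L := ⟨by omega⟩
    Real.exp (-(9 * (n : ℝ) ^ 2 * β ^ 2 * (L : ℝ) ^ 6)) ≤
      wilsonFinTorusPartition ρ β L L L (2 * t) / wilsonFinTorusPartition ρ β L L L t ^ 2 := by
  haveI : NeZero L := ⟨by omega⟩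
  have hZ : 0 < wilsonFinTorusPartition ρ β L L L t := wilsonFinTorusPartition_pos hρ β L L L t
  have h := wilsonFinTorusPartition_sq_le_exp_sq_mul_two_mul ρ hρ hρu hβ hL t
  rw [le_div_iff₀ (pow_pos hZ 2), Real.exp_neg, inv_mul_le_iff₀ (Real.exp_pos _)]
  exact h

/-- **`coldDefect ρ β L ≤ 1 − e^{−9n²β²L⁶}`** for `L ≥ 4`, `β ≥ 0`, continuous unitary `ρ` of dimension `n` on a
second-countable compact `G` (the purity `Z(L³×2t)/Z(L³×t)²`, `t = ⌊L/4⌋`, is at least `e^{−9n²β²L⁶}`).  Hypothesis-free,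
group-blind, expansion-free; quadratic in `β`. [folklore] -/
theorem coldDefect_le_one_sub_exp_sq {ρ : G →* Matrix (Fin n) (Fin n) ℂ} (hρ : Continuous ρ)
    (hρu : ∀ g, ρ g ∈ Matrix.unitaryGroup (Fin n) ℂ) {β : ℝ} (hβ : 0 ≤ β) {L : ℕ} (hL : 4 ≤ L) :
    coldDefect ρ β L ≤ 1 - Real.exp (-(9 * (n : ℝ) ^ 2 * β ^ 2 * (L : ℝ) ^ 6)) := by
  haveI : NeZero (L / 4) := ⟨by omega⟩
  have h := exp_neg_sq_le_wilsonFinTorusPartition_ratio ρ hρ hρu hβ (L := L) (by omega) (L / 4)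
  unfold coldDefect
  linarith

/-- **`coldDefect ρ β L ≤ 9·n²·β²·L⁶`** for `L ≥ 4`, `β ≥ 0` (from `1 − e^{−x} ≤ x`). [folklore] -/
theorem coldDefect_le_sq_mul {ρ : G →* Matrix (Fin n) (Fin n) ℂ} (hρ : Continuous ρ)
    (hρu : ∀ g, ρ g ∈ Matrix.unitaryGroup (Fin n) ℂ) {β : ℝ} (hβ : 0 ≤ β) {L : ℕ} (hL : 4 ≤ L) :
    coldDefect ρ β L ≤ 9 * (n : ℝ) ^ 2 * β ^ 2 * (L : ℝ) ^ 6 := by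
  have h := coldDefect_le_one_sub_exp_sq hρ hρu hβ hL
  have he := Real.add_one_le_exp (-(9 * (n : ℝ) ^ 2 * β ^ 2 * (L : ℝ) ^ 6))
  linarith

/-- **THE NUMBER's inequality at small coupling, any threshold, quadratic law**: `9·n²·β²·L⁶ ≤ θ ⇒ coldDefect ρ β L ≤ θ`
(`L ≥ 4`, `β ≥ 0`). [folklore] -/
theorem coldDefect_le_of_sq_mul_le {ρ : G →* Matrix (Fin n) (Fin n) ℂ} (hρ : Continuous ρ)
    (hρu : ∀ g, ρ g ∈ Matrix.unitaryGroup (Fin n) ℂ) {β : ℝ} (hβ : 0 ≤ β) {L : ℕ} (hL : 4 ≤ L) {θ : ℝ}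
    (hθ : 9 * (n : ℝ) ^ 2 * β ^ 2 * (L : ℝ) ^ 6 ≤ θ) : coldDefect ρ β L ≤ θ :=
  (coldDefect_le_sq_mul hρ hρu hβ hL).trans hθ

end Purity

section LatticeRepForms

variable {G : Type} [Group G] [TopologicalSpace G] [IsTopologicalGroup G] [CompactSpace G]
  [MeasurableSpace G] [BorelSpace G]

/-- **Lattice-representation form** (the binder of `ColdExitAt` / `PinnedExitAt`): for every `r : LatticeRep G`, `β ≥ 0`,
`L ≥ 4`: `coldDefect r.ρ β L ≤ 9·r.N²·β²·L⁶`. [folklore] -/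
theorem coldDefect_latticeRep_le_sq_mul (r : LatticeRep G) {β : ℝ} (hβ : 0 ≤ β) {L : ℕ} (hL : 4 ≤ L) :
    coldDefect r.ρ β L ≤ 9 * (r.N : ℝ) ^ 2 * β ^ 2 * (L : ℝ) ^ 6 := by
  haveI : SecondCountableTopology G :=
    (r.continuous.isClosedEmbedding r.injective).isEmbedding.secondCountableTopology
  exact coldDefect_le_sq_mul r.continuous r.mem_unitary hβ hL

/-- **THE NUMBER at the decl's minimum box, quadratic law: `7525·N·β ≤ 1 ⇒ δᶜ_β(8) ≤ 1/24`** for every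
`r : LatticeRep G` of dimension `N`, `β ≥ 0` (`9·N²·β²·8⁶ = 2359296·N²·β² ≤ 1/24` iff `56623104·N²β² ≤ 1`, implied by
`(7525·N·β)² ≤ 1`).  For `SU(2)`, fundamental (`N = 2`, `β_W = 2β`): `β_W ≤ 1/7525 ≈ 1.33·10⁻⁴` — twenty times the
linear slab window `1/147456` of `ColdPuritySlabDecoupling.coldDefect_eight_le_one_div_24`. -/
theorem coldDefect_eight_le_one_div_24_of_sq (r : LatticeRep G) {β : ℝ} (hβ : 0 ≤ β)
    (h : 7525 * r.N * β ≤ 1) : coldDefect r.ρ β 8 ≤ 1 / 24 := by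
  have h8 := coldDefect_latticeRep_le_sq_mul r hβ (L := 8) (by norm_num)
  have : (9 : ℝ) * (r.N : ℝ) ^ 2 * β ^ 2 * (8 : ℕ) ^ 6 = 2359296 * ((r.N : ℝ) * β) ^ 2 := by push_cast; ring
  rw [this] at h8
  have hx0 : 0 ≤ (r.N : ℝ) * β := mul_nonneg (Nat.cast_nonneg _) hβ
  have hx : (r.N : ℝ) * β ≤ 1 / 7525 := by
    rw [le_div_iff₀ (by norm_num : (0 : ℝ) < 7525)]; linarith
  have hsq : ((r.N : ℝ) * β) ^ 2 ≤ (1 / 7525) ^ 2 := pow_le_pow_left₀ hx0 hx 2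
  have : 2359296 * ((r.N : ℝ) * β) ^ 2 ≤ 1 / 24 := by nlinarith
  linarith

/-- **The `2⁻⁶` variant, quadratic law: `12288·N·β ≤ 1 ⇒ δᶜ_β(8) ≤ 2⁻⁶`** (`9·8⁶·64 = 12288²`; for `SU(2)`, fundamental:
`β_W ≤ 1/12288 ≈ 8.1·10⁻⁵`, against the linear `1/393216`). -/
theorem coldDefect_eight_le_inv_two_pow_six_of_sq (r : LatticeRep G) {β : ℝ} (hβ : 0 ≤ β)
    (h : 12288 * r.N * β ≤ 1) : coldDefect r.ρ β 8 ≤ 1 / 2 ^ 6 := by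
  have h8 := coldDefect_latticeRep_le_sq_mul r hβ (L := 8) (by norm_num)
  have : (9 : ℝ) * (r.N : ℝ) ^ 2 * β ^ 2 * (8 : ℕ) ^ 6 = (12288 * r.N * β) ^ 2 / 64 := by push_cast; ring
  rw [this] at h8
  have hx0 : 0 ≤ (12288 : ℝ) * r.N * β := by positivity
  have hsq : ((12288 : ℝ) * r.N * β) ^ 2 ≤ 1 := by nlinarith
  calc coldDefect r.ρ β 8 ≤ (12288 * r.N * β) ^ 2 / 64 := h8
    _ ≤ 1 / 64 := by linarith
    _ = 1 / 2 ^ 6 := by norm_num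

end LatticeRepForms

/-! ## §2 The transfer-matrix reading: Hopf's explicit gap with the quadratic diameter -/

section TransferGap

variable {G : Type} [Group G] [TopologicalSpace G] [IsTopologicalGroup G] [CompactSpace G]
  [MeasurableSpace G] [BorelSpace G] [SecondCountableTopology G] {n : ℕ} (ρ : G →* Matrix (Fin n) (Fin n) ℂ)
  {L : ℕ} [NeZero L]

/-- **HOPF's BOUND WITH THE QUADRATIC DIAMETER.**  `L ≥ 2`, continuous unitary `ρ`, any real `β`.  For any Hilbert basis `b`
of eigenvectors of `𝕋 = wilsonTorusTransferMatrix ρ β L` and any index `i₀` with `λ_{i₀} = ‖𝕋‖`, every other eigenvalue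
satisfies `|λᵢ| ≤ tanh((9/4)·n²β²L⁶)·‖𝕋‖` (Hopf's `tanh(Δ/4)` with `Δ = 9n²β²L⁶`; ANY real `β`; compare
`WilsonTransferGapExplicit.abs_eigenvalue_le_tanh_mul`: `tanh(3nβL³)`, `β ≥ 0`).
[cite: Hopf1963, Thm 4; EvesonNussbaum1995, Thm 6.3 pp. 52–53] -/
theorem abs_eigenvalue_le_tanh_sq_mul (hρ : Continuous ρ) (hρu : ∀ g, ρ g ∈ Matrix.unitaryGroup (Fin n) ℂ)
    (β : ℝ) (hL : 2 ≤ L) {ι : Type*}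
    (b : HilbertBasis ι ℝ (Lp ℝ 2 (Measure.pi fun _ : Edge 3 L => haarProbability G))) {lam : ι → ℝ}
    (hb : ∀ i, wilsonTorusTransferMatrix ρ β L (b i) = lam i • b i) {i₀ : ι}
    (hi₀ : lam i₀ = ‖wilsonTorusTransferMatrix ρ β L‖) {i : ι} (hi : i ≠ i₀) :
    |lam i| ≤ Real.tanh (9 / 4 * (n : ℝ) ^ 2 * β ^ 2 * (L : ℝ) ^ 6) * ‖wilsonTorusTransferMatrix ρ β L‖ := by
  set A := wilsonTorusTransferMatrix ρ β L with hA_def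
  have hsa : IsSelfAdjoint A := isSelfAdjoint_wilsonTorusTransferMatrix L hρ hρu β
  have hc : IsCompactOperator A := isCompactOperator_wilsonTorusTransferMatrix β L hρ
  have himp : IsPositivityImproving A := isPositivityImproving_wilsonTorusTransferMatrix β L hρ
  have h0 : A ≠ 0 := wilsonTorusTransferMatrix_ne_zero β L hρ
  obtain ⟨φ, hφ1, hφpos, hAφ, huniq, -⟩ := himp.exists_spectralGap hsa hc h0
  have hφ0 : φ ≠ 0 := by rw [← norm_ne_zero_iff, hφ1]; exact one_ne_zero
  have hμ := measure_ne_zero_of_ne_zero hφ0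
  have hφP : IsPositiveFun φ := hφpos.isPositiveFun hμ
  have hbi₀ : (b i₀ : Lp ℝ 2 (Measure.pi fun _ : Edge 3 L => haarProbability G)) = ⟪φ, b i₀⟫ • φ :=
    huniq _ (by rw [hb, hi₀])
  set c₀ : ℝ := ⟪φ, b i₀⟫ with hc₀_def
  have hc₀ : c₀ ≠ 0 := fun h => by
    have h1 := hbi₀
    rw [h, zero_smul] at h1
    exact b.orthonormal.ne_zero i₀ h1
  have horth : ⟪φ, b i⟫ = 0 := by
    have hφeq : φ = c₀⁻¹ • (b i₀ : Lp ℝ 2 (Measure.pi fun _ : Edge 3 L => haarProbability G)) := by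
      rw [hbi₀, smul_smul, inv_mul_cancel₀ hc₀, one_smul]
    rw [hφeq, real_inner_smul_left, b.orthonormal.2 hi.symm, mul_zero]
  have hKm := stronglyMeasurable_uncurry_wilsonSliceKernel (L := L) ρ hρ β
  obtain ⟨C, hC⟩ := exists_norm_wilsonSliceKernel_le (L := L) ρ hρ β
  have hK := wilsonSliceKernel_pos (L := L) ρ hρ β
  have hΔ : ∀ U U' V V' : GaugeConfig 3 L G, wilsonSliceKernel ρ β U V * wilsonSliceKernel ρ β U' V' ≤
      Real.exp (9 * (n : ℝ) ^ 2 * β ^ 2 * (L : ℝ) ^ 6) * (wilsonSliceKernel ρ β U V' * wilsonSliceKernel ρ β U' V) :=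
    wilsonSliceKernel_crossRatio_le_exp_sq ρ hρ hρu hL β
  have hAe := wilsonTorusTransferMatrix_ae_eq β L hρ (ρ := ρ)
  have h := abs_eigenvalue_le_tanh_mul_of_kernel_of_inner_eq_zero hKm hC hK hΔ hAe hφP hAφ (hb i)
    (b.orthonormal.ne_zero i) horth
  rwa [show (9 * (n : ℝ) ^ 2 * β ^ 2 * (L : ℝ) ^ 6) / 4 = 9 / 4 * (n : ℝ) ^ 2 * β ^ 2 * (L : ℝ) ^ 6 by ring] at h

omit [NeZero L] in
/-- **THE OPERATOR GAP WITH THE QUADRATIC DIAMETER**: `β ≥ 0`, `S ≥ 1`, continuous unitary `ρ`: for every `m` with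
`tanh((9/4)·n²β²(2S+1)⁶) ≤ e^{−m}`, `TransferOperatorGap ρ β S m`.
[cite: Hopf1963, Thm 4; EvesonNussbaum1995, p. 32 and Thm 6.3; JaffeWitten2000, §5] -/
theorem transferOperatorGap_of_tanh_sq_le (hρ : Continuous ρ) (hρu : ∀ g, ρ g ∈ Matrix.unitaryGroup (Fin n) ℂ)
    {β : ℝ} (hβ : 0 ≤ β) {S : ℕ} (hS : 1 ≤ S) {m : ℝ}
    (hm : Real.tanh (9 / 4 * (n : ℝ) ^ 2 * β ^ 2 * (2 * (S : ℝ) + 1) ^ 6) ≤ Real.exp (-m)) :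
    TransferOperatorGap ρ β S m := by
  classical
  obtain ⟨s, _, b, lam, i₀, hb, hlam, hpos, hnorm, -, -, -⟩ :=
    exists_spectralData_wilsonTorusTransferMatrix (2 * S + 1) hρ hρu hβ
  set A := wilsonTorusTransferMatrix ρ β (2 * S + 1) with hA_def
  have hsa : IsSelfAdjoint A := isSelfAdjoint_wilsonTorusTransferMatrix (2 * S + 1) hρ hρu β
  set τ : ℝ := Real.tanh (9 / 4 * (n : ℝ) ^ 2 * β ^ 2 * (2 * (S : ℝ) + 1) ^ 6) with hτ
  have hτ0 : 0 ≤ τ := by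
    rw [hτ, Real.tanh_eq_sinh_div_cosh]
    exact div_nonneg (Real.sinh_nonneg_iff.2 (by positivity)) (Real.cosh_pos _).le
  have hle : ∀ i, i ≠ i₀ → |lam i| ≤ τ * ‖A‖ := fun i hi => by
    have h := abs_eigenvalue_le_tanh_sq_mul (L := 2 * S + 1) ρ hρ hρu β (by omega) b hb hnorm hi
    push_cast at h
    exact h
  refine ⟨b i₀, b.orthonormal.1 i₀, by rw [hb, hnorm], fun w hw => ?_⟩
  have h := norm_apply_le_of_eigenbasis_of_inner_eq_zero b hsa hb i₀ (θ := τ * ‖A‖)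
    (mul_nonneg hτ0 (norm_nonneg _)) hle hw
  calc ‖A w‖ ≤ τ * ‖A‖ * ‖w‖ := h
    _ ≤ Real.exp (-m) * ‖A‖ * ‖w‖ :=
        mul_le_mul_of_nonneg_right (mul_le_mul_of_nonneg_right hm (norm_nonneg _)) (norm_nonneg _)

omit [NeZero L] in
/-- **THE TRACE-FORM GAP WITH THE QUADRATIC DIAMETER**: `β ≥ 0`, `S ≥ 1`, continuous unitary `ρ`,
`tanh((9/4)·n²β²(2S+1)⁶) ≤ e^{−m}` ⇒ `TransferGap ρ β S m` (tree `transferOperatorGap_iff_transferGap`).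
In particular `m = −log tanh((9/4)·n²β²(2S+1)⁶)` — logarithmically LARGE as `β → 0` at fixed volume, where the
linear-diameter value `−log tanh(3nβ(2S+1)³)` of `WilsonTransferGapExplicit.transferGap_neg_log_tanh` is not.
Finite-volume statement; NOT a mass gap. [cite: Hopf1963, Thm 4; EvesonNussbaum1995, Thm 6.3 and p. 32] -/
theorem transferGap_of_tanh_sq_le (hρ : Continuous ρ) (hρu : ∀ g, ρ g ∈ Matrix.unitaryGroup (Fin n) ℂ)
    {β : ℝ} (hβ : 0 ≤ β) {S : ℕ} (hS : 1 ≤ S) {m : ℝ}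
    (hm : Real.tanh (9 / 4 * (n : ℝ) ^ 2 * β ^ 2 * (2 * (S : ℝ) + 1) ^ 6) ≤ Real.exp (-m)) : TransferGap ρ β S m :=
  (transferOperatorGap_iff_transferGap hρ hρu hβ S m).1 (transferOperatorGap_of_tanh_sq_le ρ hρ hρu hβ hS hm)

omit [NeZero L] in
/-- **Every finite torus of side `2S+1 ≥ 3` has the explicit transfer gap `m = −log tanh((9/4)·n²β²(2S+1)⁶)`**
(`β ≥ 0`, continuous unitary `ρ`). [cite: Hopf1963, Thm 4; EvesonNussbaum1995, Thm 6.3 pp. 52–53] -/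
theorem transferGap_neg_log_tanh_sq (hρ : Continuous ρ) (hρu : ∀ g, ρ g ∈ Matrix.unitaryGroup (Fin n) ℂ)
    {β : ℝ} (hβ : 0 ≤ β) {S : ℕ} (hS : 1 ≤ S) :
    TransferGap ρ β S (-Real.log (Real.tanh (9 / 4 * (n : ℝ) ^ 2 * β ^ 2 * (2 * (S : ℝ) + 1) ^ 6))) := by
  refine transferGap_of_tanh_sq_le ρ hρ hρu hβ hS ?_
  by_cases ht : 0 < Real.tanh (9 / 4 * (n : ℝ) ^ 2 * β ^ 2 * (2 * (S : ℝ) + 1) ^ 6)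
  · rw [neg_neg, Real.exp_log ht]
  · -- degenerate case `tanh(…) ≤ 0` (i.e. `n = 0` or `β = 0`): the hypothesis holds for every `m`
    exact (not_lt.1 ht).trans (Real.exp_pos _).le

end TransferGap

end Summit.QuantumFields.YangMills.Cruxes.IR.ColdPurityGaussLaw

end
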